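import Summits.QuantumAdvantage.QuantumAdvantage.Theorems.MobiusLadderLiouvilleOrthogonalTC0Spectral
import Literature.NumberTheory.Sieve.MoebiusWalshCircuitsHolds
import HarnessLib

/-!
# Crux `MobiusLadder.LiouvilleOrthogonalTC0` (stmt-QuantumAdvantage-1393), line `Sketch`, skeleton v10:
stub `stub_spectral_moebius` — the spectral criterion for `μ`

The Möbius twin of the landed spectral criterion `liouville_orthogonal_of_tailWeight`
(`MobiusLadderLiouvilleOrthogonalTC0Spectral.lean`), i.e. Kalai's formulation of Möbius randomness
for every UNIFORMLY noise-stable class of Boolean functions of the binary digits: if `τ(m) → 0`,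
then for every `ε > 0`, eventually in `n`, EVERY Boolean function `F` of `n` bits whose Fourier
tails obey `W^{≥ m}[sgn ∘ F] ≤ τ(m)` for all `m ≥ 1` satisfies
`|Σ_{N<2ⁿ} μ(N) sgn F(bits N)| ≤ ε 2ⁿ`; the threshold `n₀(ε, τ)` does not depend on `F`.

Proof: verbatim the `λ` proof — Green 2012 §2 (`GreenAC0.core_bound`) with the empty and the small
characters (`1 ≤ |S| ≤ k = ⌊n^{1/R}⌋₊`, `R = ⌈3/c⌉₊`, `c = 1/10`) bounded by Bourgain's uniform
Möbius–Walsh bound, which for `μ` is PROVED in the tree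
(`Literature.NumberTheory.Sieve.bourgain_moebius_walsh_holds`: `|Σ_{x<2ⁿ} μ(x) w_A(x)| < 2^{n-n^{1/10}}`
for all `A`, eventually in `n`; arithmetic `LtfCore.low_term_le`), and the tail at level `k + 1` by
the hypothesis, `√τ(k+1) ≤ ε/3` eventually because `k → ∞` (`Spectral.eventually_params`).
-/

set_option linter.dupNamespace false -- D-0017: single-problem summit ⇒ `QuantumAdvantage.QuantumAdvantage` by design

noncomputable section

namespace Summit.QuantumAdvantage.QuantumAdvantage.Theorems.LiouvilleOrthogonalTC0

open Filter Finset Topology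
open Literature.Computability.Complexity
open Literature.Computability.Complexity.LowDegree (tailWeight)
open Literature.Probability.RandomGraphs.LowDegree (sgn walsh walsh_empty)
open Literature.NumberTheory.Sieve

namespace StubSpectralMoebius

/-- Bourgain's uniform Möbius–Walsh bound (`bourgain_moebius_walsh_holds`: exponent `1/10`, strict
inequality), in the non-strict form used below: eventually in `n`, for every `A ⊆ {0,…,n-1}`,
`|Σ_{N<2ⁿ} μ(N) w_A(bits N)| ≤ 2^{n - n^{1/10}}`. -/
theorem eventually_walsh_bound : ∀ᶠ n : ℕ in atTop, ∀ A : Finset (Fin n),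
    |∑ N ∈ Finset.range (2 ^ n), ((ArithmeticFunction.moebius N : ℤ) : ℝ) *
        walsh A (fun j : Fin n => Nat.testBit N j)|
      ≤ (2 : ℝ) ^ ((n : ℝ) - (n : ℝ) ^ ((1 : ℝ) / 10)) := by
  have hWLB := bourgain_moebius_walsh_holds
  unfold bourgain_moebius_walsh at hWLB
  exact hWLB.mono fun n hn A => (hn A).le

open Spectral in
/-- **The spectral criterion for Möbius randomness of digital functions (`μ` form).** Let
`τ : ℕ → ℝ` with `τ(m) → 0`. For every `ε > 0`, for all sufficiently large `n`, every Boolean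
function `F` of `n` bits with Fourier tails `W^{≥ m}[sgn ∘ F] ≤ τ(m)` for all `m ≥ 1` satisfies
`|Σ_{N<2ⁿ} μ(N) · sgn F(bits N)| ≤ ε · 2ⁿ`. (Bourgain's uniform Möbius–Walsh bound for `μ`,
proved in the tree, + Green's §2 deduction; the threshold `n₀(ε, τ)` does not depend on `F`.) -/
theorem moebius_orthogonal_of_tailWeight (τ : ℕ → ℝ) (hτ : Tendsto τ atTop (nhds 0)) :
    ∀ ε : ℝ, 0 < ε → ∀ᶠ n : ℕ in atTop, ∀ F : (Fin n → Bool) → Bool,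
      (∀ m : ℕ, 1 ≤ m → tailWeight (fun x : Fin n → Bool => sgn (F x)) m ≤ τ m) →
        |∑ N ∈ Finset.range (2 ^ n), ((ArithmeticFunction.moebius N : ℤ) : ℝ) *
            sgn (F (fun i : Fin n => Nat.testBit N i))| ≤ ε * (2 : ℝ) ^ n := by
  intro ε hε
  have hWLB := eventually_walsh_bound
  -- Bourgain's exponent for `μ`
  set c : ℝ := (1 : ℝ) / 10 with hcdef
  have hc : 0 < c := by norm_num [hcdef]
  have hB : ∀ᶠ n : ℕ in atTop, ∀ A : Finset (Fin n),
      |∑ N ∈ Finset.range (2 ^ n), ((ArithmeticFunction.moebius N : ℤ) : ℝ) *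
          walsh A (fun j : Fin n => Nat.testBit N j)| ≤ (2 : ℝ) ^ ((n : ℝ) - (n : ℝ) ^ c) :=
    hWLB
  -- parameters
  set R : ℕ := ⌈(3 : ℝ) / c⌉₊ with hRdef
  have hR1 : 1 ≤ R := by
    have : (0 : ℝ) < 3 / c := by positivity
    exact Nat.one_le_iff_ne_zero.mpr (Nat.pos_iff_ne_zero.mp (Nat.ceil_pos.mpr this))
  have hRc : 3 ≤ (R : ℝ) * c := by
    have h1 : (3 : ℝ) / c ≤ R := Nat.le_ceil _
    have := mul_le_mul_of_nonneg_right h1 hc.le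
    rwa [div_mul_cancel₀ _ hc.ne'] at this
  filter_upwards [hB, eventually_params hR1 hε hτ] with n hBn hpar F hF
  obtain ⟨hRk, hηk, hτk⟩ := hpar
  set k : ℕ := ⌊((n : ℝ)) ^ ((1 : ℝ) / R)⌋₊ with hkdef
  -- pass to the cube
  rw [MoebiusWalsh.sum_range_two_pow_eq_sum_cube
    (fun N => ((ArithmeticFunction.moebius N : ℤ) : ℝ) * sgn (F (fun i : Fin n => Nat.testBit N i)))]
  simp only [MoebiusWalsh.ofFn_testBit_bitsToNat]
  set f : (Fin n → Bool) → ℝ := fun y => sgn (F y) with hfdef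
  set G : (Fin n → Bool) → ℝ := fun y =>
    ((ArithmeticFunction.moebius (bitsToNat (List.ofFn y)) : ℤ) : ℝ) with hGdef
  have hG : ∀ y, |G y| ≤ 1 := fun y => by
    -- `|μ| ≤ 1` (Mathlib's `ArithmeticFunction.abs_moebius_le_one`, an `ℤ` statement)
    simp only [hGdef]; exact_mod_cast ArithmeticFunction.abs_moebius_le_one
  have hf : ∀ y, |f y| ≤ 1 := fun y => by
    simp only [hfdef]; unfold sgn; split_ifs <;> simp
  -- Bourgain's bound on the cube, for every character
  set B : ℝ := (2 : ℝ) ^ ((n : ℝ) - (n : ℝ) ^ c) with hBdef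
  have hWalsh : ∀ A : Finset (Fin n), |∑ y, G y * walsh A y| ≤ B := by
    intro A
    have h := hBn A
    rw [MoebiusWalsh.sum_range_two_pow_eq_sum_cube
      (fun N => ((ArithmeticFunction.moebius N : ℤ) : ℝ) *
        walsh A (fun j : Fin n => N.testBit j))] at h
    simp only [MoebiusWalsh.ofFn_testBit_bitsToNat] at h
    exact h
  have h0 : |∑ y, G y| ≤ B := by simpa using hWalsh ∅
  have hB0 : 0 ≤ B := by positivity
  have hcore := GreenAC0.core_bound (k := k) f G hf hG (E₀ := B) (E₁ := B)
    (τ := τ (k + 1)) hB0 h0 (fun S _ _ => hWalsh S) (hF (k + 1) (by omega))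
  change |∑ y, G y * f y| ≤ ε * 2 ^ n
  refine hcore.trans ?_
  -- the three cost terms
  have hkn : k ^ R ≤ n := LtfCore.floor_rpow_pow_le hR1 n
  have hnk : n < (k + 1) ^ R := LtfCore.lt_floor_rpow_succ_pow hR1 n
  have hlow : ((n : ℝ) + 1) ^ k * B ≤ ε / 3 * 2 ^ n := LtfCore.low_term_le hc hRc hkn hnk hRk hηk
  have hE0 : B ≤ ε / 3 * 2 ^ n := by
    refine le_trans ?_ hlow
    refine le_mul_of_one_le_left hB0 ?_
    exact one_le_pow₀ (by linarith [(Nat.cast_nonneg n : (0 : ℝ) ≤ n)])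
  have hε3 : 0 < ε / 3 := by positivity
  have hsqrt : Real.sqrt (τ (k + 1)) ≤ ε / 3 := by
    rw [← Real.sqrt_sq hε3.le]; exact Real.sqrt_le_sqrt hτk
  have htail : (2 : ℝ) ^ n * Real.sqrt (τ (k + 1)) ≤ ε / 3 * 2 ^ n := by
    rw [mul_comm]
    exact mul_le_mul_of_nonneg_right hsqrt (by positivity)
  linarith

/-- **Corollary (uniformly noise-stable classes, `μ` form).** If a class `𝓕` of Boolean functions
(one set for each input length) has a uniform Fourier-tail bound `W^{≥ m}[sgn ∘ F] ≤ τ(m)`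
(`m ≥ 1`, `F ∈ 𝓕 n`) with `τ(m) → 0`, then `μ` is asymptotically orthogonal to `𝓕`: for every
`ε > 0`, eventually in `n`, `|Σ_{N<2ⁿ} μ(N) sgn F(bits N)| ≤ ε 2ⁿ` for all `F ∈ 𝓕 n`. -/
theorem moebius_orthogonal_of_uniform_tail (𝓕 : ∀ n : ℕ, Set ((Fin n → Bool) → Bool))
    (τ : ℕ → ℝ) (hτ : Tendsto τ atTop (nhds 0))
    (h𝓕 : ∀ n, ∀ F ∈ 𝓕 n, ∀ m : ℕ, 1 ≤ m → tailWeight (fun x : Fin n → Bool => sgn (F x)) m ≤ τ m) :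
    ∀ ε : ℝ, 0 < ε → ∀ᶠ n : ℕ in atTop, ∀ F ∈ 𝓕 n,
      |∑ N ∈ Finset.range (2 ^ n), ((ArithmeticFunction.moebius N : ℤ) : ℝ) *
          sgn (F (fun i : Fin n => Nat.testBit N i))| ≤ ε * (2 : ℝ) ^ n := by
  intro ε hε
  filter_upwards [moebius_orthogonal_of_tailWeight τ hτ ε hε] with n hn F hF
  exact hn F (h𝓕 n F hF)

end StubSpectralMoebius

/-- **Registered stub `stub_spectral_moebius`** (line `Sketch`, skeleton v10): the spectral
criterion for `μ` — Kalai's form of Möbius randomness for every uniformly noise-stable class of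
Boolean functions of the binary digits — verbatim `StubSpectralMoebius.moebius_orthogonal_of_tailWeight`
(Bourgain's proved uniform Möbius–Walsh bound `bourgain_moebius_walsh_holds` + Green's §2 deduction
`GreenAC0.core_bound`). -/
theorem stub_spectral_moebius (τ : ℕ → ℝ) (hτ : Tendsto τ atTop (nhds 0)) : ∀ ε : ℝ, 0 < ε → ∀ᶠ n : ℕ in atTop, ∀ F : (Fin n → Bool) → Bool, (∀ m : ℕ, 1 ≤ m → tailWeight (fun x : Fin n → Bool => sgn (F x)) m ≤ τ m) → |∑ N ∈ Finset.range (2 ^ n), ((ArithmeticFunction.moebius N : ℤ) : ℝ) * sgn (F (fun i : Fin n => Nat.testBit N i))| ≤ ε * (2 : ℝ) ^ n := by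
  exact StubSpectralMoebius.moebius_orthogonal_of_tailWeight τ hτ

end Summit.QuantumAdvantage.QuantumAdvantage.Theorems.LiouvilleOrthogonalTC0
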